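import Literature.Combinatorics.Sahi2008.Functional

/-!
# `NoHeavyLowerTail` (stmt-CriticalPhenomena-4575) — Sahi's functionals on the DIAGONAL: the first Hankel
# (Stieltjes-moment) inequality `2·E(g)·E₃(g,g,g) ≥ 3·E₂(g,g)²`

Support file of the `|A| = 5` / master-family surge, seat `prim-l12-p5` (technique lane: generating polynomials,
Lorentzian / stable / total-positivity structure), `--supports stmt-CriticalPhenomena-4575`.  Everything here is PROVED;
no definitions, no named facts.

## What is proved

For a nonnegative weight `μ` of total mass `1` on a finite type and ONE nonnegative function `g` (no order, no lattice
condition), with `m₁ = E g`, `m₂ = E g²`, `m₃ = E g³`: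

* `ex_sq_le_ex_sq'` : `(E g)² ≤ E(g²)`  (variance, any `g`);
* `ex_sq_sq_le_ex_mul_ex_cube` : `E(g²)² ≤ E(g)·E(g³)` for `g ≥ 0`  (Cauchy–Schwarz with the weight `μ·g`, via the
  discriminant of `c ↦ Σ μ g (c − g)²`);
* `sahiE_three_diag` : `E₃(g,g,g) = 2m₃ − 3m₁m₂ + m₁³`, `sahiE_two_diag` : `E₂(g,g) = m₂ − m₁²`;
* **`sahiE_diag_hankel₂`** : `3·E₂(g,g)² ≤ 2·E(g)·E₃(g,g,g)`, i.e. with `cₙ := Eₙ(g,…,g)/n!` the `2 × 2` Hankel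
  inequality `c₂² ≤ c₁c₃` (equivalently `4m₁m₃ − 3m₂² − m₁⁴ ≥ 0`), and its corollary
  `sahiE_three_diag_nonneg` : `E₃(g,g,g) ≥ 0` re-derived (the diagonal of Blinovsky's chain theorem, tree
  `Literature.Combinatorics.Sahi2008.sahiE_indicator_nonneg_of_total`, here for an arbitrary nonnegative `g`),
  and `sahiE_three_diag_pos_of_var_pos` : `E₃(g,g,g) > 0` as soon as `Var g > 0`.

## Why (the structure behind it; NOT formalised here, recorded for the cell)

Sahi's generating function [Sahi2008, Conj. 4 ⟺ Conj. 5; LiebSahi2021, Conj. 1.2] on the diagonal is the μ-GEOMETRIC MEAN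
`G(t) = Π_x (1 − t g(x))^{μ(x)} = 1 − Σ_{n≥1} cₙ tⁿ` with `cₙ = Eₙ(g,…,g)/n!`.  Its reciprocal
`F = 1/G = Π_x (1 − t g(x))^{−μ(x)}` is a geometric mean of generating functions of Stieltjes moment sequences
(`(g(x)ⁿ)ₙ`), hence itself one [Hansen 1988 (thesis "Monotonicity properties of infinitely divisible distributions"),
Cor. 1 to Thm. 3.3.4: `UᵃVᵇ`, `a, b ≥ 0`, `a + b ≤ 1`, preserves Stieltjes-moment coefficient sequences], and by Horn's
theorem on renewal pairs [Horn 1970; Hansen loc. cit. Thm. 2.3.3 (ii); Kaluza 1928 for the sign] the renewal coefficients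
`(c_{n+1})_{n ≥ 0}` of a Stieltjes moment sequence form a Stieltjes moment sequence.  So ALL Hankel matrices
`[c_{i+j+1}]`, `[c_{i+j+2}]` are positive semidefinite (checked exactly on random rational instances, seat folder
`work/py/diag_stieltjes.py`, 25/25, orders ≤ 9); this file proves the first non-trivial minor.  This log-CONVEXITY /
total-positivity structure along rays of the cone `{Σ tᵢ fᵢ : t ≥ 0}` is the property that survives from the
"Lorentzian / stable polynomial" lane: the Lorentzian (log-CONCAVITY, negative-dependence) properties all FAIL for the
`E`-hierarchy (companion file `…PatternPolynomialNoGo`).  It is blind to monotonicity and does not by itself give the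
off-diagonal `C₃` (report run/shared/lean/prim/prim-l12/prim-l12-p5/P5-REPORT.md).
-/

namespace Summit.CriticalPhenomena.PercolationContinuityZ3.Theorems

namespace SahiDiagonalHankel

open Finset Literature.Combinatorics.Sahi2008

variable {α : Type*} [Fintype α]

/-- Weighted sum of a shifted square: `Σ μ (g − c)² = E(g²) − 2c·E(g) + c²·Σμ`. [folklore] -/
theorem sum_mul_sq_sub (μ g : α → ℝ) (c : ℝ) :
    ∑ x, μ x * (g x - c) ^ 2 = ex μ (g * g) - 2 * c * ex μ g + c ^ 2 * ∑ x, μ x := by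
  simp only [ex, Pi.mul_apply, Finset.mul_sum, ← Finset.sum_sub_distrib, ← Finset.sum_add_distrib]
  exact Finset.sum_congr rfl fun x _ => by ring

/-- Weighted sum `Σ μ·g·(c − g)² = c²·E(g) − 2c·E(g²) + E(g³)`. [folklore] -/
theorem sum_mul_mul_sq_sub (μ g : α → ℝ) (c : ℝ) :
    ∑ x, μ x * g x * (c - g x) ^ 2 = c ^ 2 * ex μ g - 2 * c * ex μ (g * g) + ex μ (g * g * g) := by
  simp only [ex, Pi.mul_apply, Finset.mul_sum, ← Finset.sum_sub_distrib, ← Finset.sum_add_distrib]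
  exact Finset.sum_congr rfl fun x _ => by ring

/-- **Variance inequality** `(E g)² ≤ E(g²)` for a nonnegative weight of total mass `1`. [folklore] -/
theorem ex_sq_le_ex_sq' {μ : α → ℝ} (hμ : ∀ x, 0 ≤ μ x) (hμ₁ : ∑ x, μ x = 1) (g : α → ℝ) :
    ex μ g ^ 2 ≤ ex μ (g * g) := by
  have h : 0 ≤ ∑ x, μ x * (g x - ex μ g) ^ 2 :=
    Finset.sum_nonneg fun x _ => mul_nonneg (hμ x) (sq_nonneg _)
  rw [sum_mul_sq_sub, hμ₁] at h
  nlinarith [h]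

/-- **Weighted Cauchy–Schwarz** `E(g²)² ≤ E(g)·E(g³)` for `g ≥ 0` under a nonnegative weight (the quadratic
`c ↦ Σ μ g (c − g)² = E(g)c² − 2E(g²)c + E(g³)` is nonnegative, so its discriminant is `≤ 0`). [folklore] -/
theorem ex_sq_sq_le_ex_mul_ex_cube {μ : α → ℝ} (hμ : ∀ x, 0 ≤ μ x) {g : α → ℝ} (hg : ∀ x, 0 ≤ g x) :
    ex μ (g * g) ^ 2 ≤ ex μ g * ex μ (g * g * g) := by
  have hq : ∀ c : ℝ, 0 ≤ ex μ g * (c * c) + (-2 * ex μ (g * g)) * c + ex μ (g * g * g) := by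
    intro c
    have h : 0 ≤ ∑ x, μ x * g x * (c - g x) ^ 2 :=
      Finset.sum_nonneg fun x _ => mul_nonneg (mul_nonneg (hμ x) (hg x)) (sq_nonneg _)
    rw [sum_mul_mul_sq_sub] at h
    nlinarith [h]
  have hd := discrim_le_zero hq
  rw [discrim] at hd
  nlinarith [hd]

/-- `E₃` on the diagonal: `E₃(g,g,g) = 2E(g³) − 3E(g)E(g²) + E(g)³`. [cite: Sahi2008, p. 213; LiebSahi2021, eq. (2.1)] -/
theorem sahiE_three_diag (μ g : α → ℝ) :
    sahiE μ 3 ![g, g, g] = 2 * ex μ (g * g * g) - 3 * ex μ g * ex μ (g * g) + ex μ g ^ 3 := by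
  rw [sahiE_three]
  ring

/-- `E₂` on the diagonal is the variance: `E₂(g,g) = E(g²) − E(g)²`. [cite: LiebSahi2021, eq. (1.1)] -/
theorem sahiE_two_diag (μ g : α → ℝ) : sahiE μ 2 ![g, g] = ex μ (g * g) - ex μ g ^ 2 := by
  rw [sahiE_two]
  ring

/-- **First Hankel (Stieltjes) inequality on the diagonal of Sahi's hierarchy**: for a nonnegative weight of
total mass `1` and `g ≥ 0`, `3·E₂(g,g)² ≤ 2·E(g)·E₃(g,g,g)` — with `cₙ = Eₙ(g,…,g)/n!` this is `c₂² ≤ c₁c₃`, the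
`2 × 2` minor of the Hankel matrix of the renewal coefficients of the geometric mean `Π_x(1 − t g(x))^{μ(x)}`.  In
moments: `4m₁m₃ − 3m₂² − m₁⁴ ≥ 0`, from `m₂ ≥ m₁²` and `m₁m₃ ≥ m₂²`. [this file] -/
theorem sahiE_diag_hankel₂ {μ : α → ℝ} (hμ : ∀ x, 0 ≤ μ x) (hμ₁ : ∑ x, μ x = 1) {g : α → ℝ}
    (hg : ∀ x, 0 ≤ g x) :
    3 * sahiE μ 2 ![g, g] ^ 2 ≤ 2 * ex μ g * sahiE μ 3 ![g, g, g] := by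
  rw [sahiE_three_diag, sahiE_two_diag]
  have h1 := ex_sq_le_ex_sq' hμ hμ₁ g
  have h2 := ex_sq_sq_le_ex_mul_ex_cube hμ hg
  have hm2 : 0 ≤ ex μ (g * g) := ex_nonneg hμ fun x => mul_nonneg (hg x) (hg x)
  nlinarith [h1, h2, hm2, mul_nonneg (sub_nonneg.2 h1) (add_nonneg hm2 (sq_nonneg (ex μ g)))]

/-- **`E₃(g,g,g) ≥ 0`** for every nonnegative `g` under a nonnegative weight of mass `1` (the diagonal of
Blinovsky's / Lieb–Sahi's chain theorem, re-derived from the two moment inequalities: `2m₃ − 3m₁m₂ + m₁³ ≥ 0`).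
[cite: Blinovsky2013FormalSeries, Lemma 1; LiebSahi2021, Lemma 3.2] -/
theorem sahiE_three_diag_nonneg {μ : α → ℝ} (hμ : ∀ x, 0 ≤ μ x) (hμ₁ : ∑ x, μ x = 1) {g : α → ℝ}
    (hg : ∀ x, 0 ≤ g x) : 0 ≤ sahiE μ 3 ![g, g, g] := by
  rw [sahiE_three_diag]
  have h1 := ex_sq_le_ex_sq' hμ hμ₁ g
  have h2 := ex_sq_sq_le_ex_mul_ex_cube hμ hg
  have hm1 : 0 ≤ ex μ g := ex_nonneg hμ hg
  have hm2 : 0 ≤ ex μ (g * g) := ex_nonneg hμ fun x => mul_nonneg (hg x) (hg x)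
  -- if m₁ = 0 then m₂ = 0 (from h1? no: need m₂ ≤ ... ) — use m₁·(target) ≥ 0 form and case on m₁
  by_cases h0 : ex μ g = 0
  · -- then every term with m₁ vanishes and E(g³) ≥ 0
    have hm3 : 0 ≤ ex μ (g * g * g) :=
      ex_nonneg hμ fun x => mul_nonneg (mul_nonneg (hg x) (hg x)) (hg x)
    rw [h0]
    nlinarith [hm3]
  · have hpos : 0 < ex μ g := lt_of_le_of_ne hm1 (Ne.symm h0)
    -- m₁ · (2m₃ − 3m₁m₂ + m₁³) = 2m₁m₃ − 3m₁²m₂ + m₁⁴ ≥ 2m₂² − 3m₁²m₂ + m₁⁴ = (2m₂ − m₁²)(m₂ − m₁²) ≥ 0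
    have key : 0 ≤ ex μ g * (2 * ex μ (g * g * g) - 3 * ex μ g * ex μ (g * g) + ex μ g ^ 3) := by
      nlinarith [h1, h2, hm2, mul_nonneg (sub_nonneg.2 h1) (by nlinarith [h1, hm2] :
        (0:ℝ) ≤ 2 * ex μ (g * g) - ex μ g ^ 2)]
    exact (mul_nonneg_iff_of_pos_left hpos).1 key

/-- **Strict positivity off the constants**: if `Var g > 0` then `E₃(g,g,g) > 0` (from `c₂² ≤ c₁c₃` and
`c₁ = E g > 0`).  So on the diagonal the equality locus of `E₃` is exactly `{g constant μ-a.e.}`. [this file] -/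
theorem sahiE_three_diag_pos_of_var_pos {μ : α → ℝ} (hμ : ∀ x, 0 ≤ μ x) (hμ₁ : ∑ x, μ x = 1)
    {g : α → ℝ} (hg : ∀ x, 0 ≤ g x) (hvar : 0 < sahiE μ 2 ![g, g]) : 0 < sahiE μ 3 ![g, g, g] := by
  have hH := sahiE_diag_hankel₂ hμ hμ₁ hg
  have hm1 : 0 ≤ ex μ g := ex_nonneg hμ hg
  have h3 : 0 < 3 * sahiE μ 2 ![g, g] ^ 2 := by positivity
  have h4 : 0 < 2 * ex μ g * sahiE μ 3 ![g, g, g] := lt_of_lt_of_le h3 hH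
  by_contra hneg
  push Not at hneg
  have : 2 * ex μ g * sahiE μ 3 ![g, g, g] ≤ 0 :=
    mul_nonpos_of_nonneg_of_nonpos (by positivity) hneg
  linarith

end SahiDiagonalHankel

end Summit.CriticalPhenomena.PercolationContinuityZ3.Theorems
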